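/-
HONEST FRAMING: certified error envelopes and provably optimal rounding/accumulation schemes for
low-precision formats under stated cost models; every table by two implementations; no hardware
or vendor claims.
-/
import Summits.Ventures.CertifiedArithmetic.LowPrec.OptDemotionRoutingELevel

/-!
# The demotion law (Theorem T8), part 12-4: EVERY `E`-row of opt's split AT ITS LEVEL'S OWN WEIGHT — `E(2^k, B, ρ)` for all `ρ ≤ 2^-(k+2)`, every level, offset, tree, `q`

By value (budget units of parts 9d/10e): for every precision `q`, every level `β = 2^k`
(`k + 2 ≤ q`), every offset `B < β`, every weight `0 ≤ ρ ≤ 2^-(k+2)` and every summation tree,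

  `E(β, B, ρ):  2·BR_t(β + B) ≤ (1 - ρ)·BR_t(2β + B) + (1 + ρ)·BR_t(B + ½)`

(`eRow_level`) — part 12-3 `treeBR_eRow_level` at the bits of `B` read from the top `k + 1` with the
half bit at `h = -(k+2)`, scaled by homogeneity (part 8j); no (M) step, so nothing is lost below
the top level.  At the top (`k = q-2`) the admissible weight is `u` (Part 11); one level down it is
`2u`, then `4u`, …, `¼` at `k = 0` — against the `B = 0` threshold `1/(2^(k+2) - 1)` (part 10e
`eRow_zero`) and opt's measured o-side needs (R22, q = 6: `sup_O = 0.95u, 0.89u, 0.79u, 1.37u, 1.85u`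
for `β = 2^(q-1)·(½ … 1/32)` versus the e-side supply here `u, 2u, 4u, 8u, 16u`).  Packaging:
`eSide_level`, and `TTlow_of_oRows_level` / `conjectureD_of_oRows_level` /
`routingBound_of_oRows_level`: R29, Conjecture D for every tree and W = BR at every precision
`q ≥ 2` follow from the `O`-ROWS ALONE at any per-level weights `0 ≤ ρ_k ≤ 2^-(k+2)` — a window
that, by R22's data, contains the o-side floors at every level (the top level being the tight one).
Supersedes part 11-6's packaging (weights `≤ u`).
-/

namespace Summit.Ventures.CertifiedArithmetic.LowPrec.Opt

open Literature.ComputerArithmetic.JeannerodRump2018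
open Literature.ComputerArithmetic.JeannerodRump2018.SumTree

section ERowsLevel

variable {q : ℕ}

/-- **EVERY `E`-ROW AT ITS LEVEL'S WEIGHT**: for a level `k + 2 ≤ q`, any offset `B < 2^k`, any weight
`0 ≤ ρ ≤ 2^-(k+2)` and every tree, `E(2^k, B, ρ)`. -/
theorem eRow_level (t : SumTree) {k B : ℕ} (hk : k + 2 ≤ q) (hB : B < 2 ^ k) {ρ : ℚ} (hρ0 : 0 ≤ ρ)
    (hρ : ρ ≤ (2 : ℚ) ^ (-((k : ℤ) + 2))) : ERow q t ρ k B := by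
  classical
  have hq1 : 1 ≤ q := by omega
  rcases Nat.eq_zero_or_pos B with rfl | hB1
  · refine eRow_zero hq1 t ?_
    have h1 : ρ * (2 : ℚ) ^ (k + 2) ≤ 1 := by
      calc ρ * (2 : ℚ) ^ (k + 2) ≤ (2 : ℚ) ^ (-((k : ℤ) + 2)) * (2 : ℚ) ^ (k + 2) :=
            mul_le_mul_of_nonneg_right hρ (by positivity)
        _ = 1 := by
            rw [← zpow_natCast, ← zpow_add₀ (by norm_num : (2 : ℚ) ≠ 0)]
            norm_num
    nlinarith [h1, hρ0]
  -- the bits of `B`, read from the top `k + 1`; the half bit at `h = -(k+2)`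
  set I : Finset ℤ := natBits B with hI
  have hIb : ∀ e ∈ I, 0 ≤ e ∧ e < (k : ℤ) := fun e he => natBits_lt hB he
  have hIne : I.Nonempty := natBits_nonempty hB1
  set S : Finset ℤ := I.image (fun e => e + -((k : ℤ) + 1)) with hSdef
  have hS : ∀ s ∈ S, -((k : ℤ) + 2) + 1 ≤ s ∧ s ≤ -2 := by
    intro s hs
    obtain ⟨e, he, rfl⟩ := Finset.mem_image.1 hs
    have := hIb e he
    omega
  have hSne : S.Nonempty := hIne.image _
  have h := treeBR_eRow_level (q := q) S (-((k : ℤ) + 2)) ρ (by omega) hρ0 hρ hS hSne t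
  -- shift up by `k + 1`
  have eS : S.image (fun e => e + ((k : ℤ) + 1)) = I := image_neg_image_add I _
  have s1 := treeBR_image_add (q := q) t (insert (-1) S) ((k : ℤ) + 1)
  have s0 := treeBR_image_add (q := q) t (insert 0 S) ((k : ℤ) + 1)
  have sh := treeBR_image_add (q := q) t (insert (-((k : ℤ) + 2)) S) ((k : ℤ) + 1)
  rw [Finset.image_insert, eS] at s1 s0 sh
  rw [show (-1 : ℤ) + ((k : ℤ) + 1) = k by ring] at s1
  rw [show (0 : ℤ) + ((k : ℤ) + 1) = (k : ℤ) + 1 by ring] at s0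
  rw [show -((k : ℤ) + 2) + ((k : ℤ) + 1) = -1 by ring] at sh
  -- the three values
  have hkI : (k : ℤ) ∉ I := fun h => by have := hIb _ h; omega
  have hk1I : (k : ℤ) + 1 ∉ I := fun h => by have := hIb _ h; omega
  have he : (2 : ℚ) ^ k + (B : ℚ) = val (insert (k : ℤ) I) := by
    rw [val_insert hkI, hI, val_natBits, zpow_natCast]
  have he1 : (2 : ℚ) ^ k + (B : ℚ) + (2 : ℚ) ^ k = val (insert ((k : ℤ) + 1) I) := by
    rw [val_insert hk1I, hI, val_natBits, zpow_add_one₀ (by norm_num : (2 : ℚ) ≠ 0), zpow_natCast]; ring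
  have he2 : (2 : ℚ) ^ k + (B : ℚ) - (2 : ℚ) ^ k + 1 / 2 = val (insert (-1) I) := by
    rw [hI, val_insert_neg_one]; ring
  unfold ERow
  rw [he1, he2, he, treeBRv_val, treeBRv_val, treeBRv_val, s1, s0, sh]
  have hpos : 0 < (2 : ℚ) ^ ((k : ℤ) + 1) := zpow_pos (by norm_num) _
  have h' := mul_le_mul_of_nonneg_left h hpos.le
  linear_combination h'

/-- **THE WHOLE E-SIDE OF THE ROW SYSTEM AT PER-LEVEL WEIGHTS**: for any weights
`0 ≤ ρ_k ≤ 2^-(k+2)`, every level `k + 2 ≤ q`, every tree and every `B < 2^k`, `ERow q t (ρ_k) k B`. -/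
theorem eSide_level (rho : ℕ → ℚ) (h0 : ∀ k, k + 2 ≤ q → 0 ≤ rho k)
    (hle : ∀ k, k + 2 ≤ q → rho k ≤ (2 : ℚ) ^ (-((k : ℤ) + 2))) :
    ∀ (k : ℕ) (t : SumTree) (B : ℕ), k + 2 ≤ q → B < 2 ^ k → ERow q t (rho k) k B :=
  fun k t _ hk hB => eRow_level t hk hB (h0 k hk) (hle k hk)

/-- **R29 FROM THE O-SIDE ALONE, PER-LEVEL WEIGHTS**: if for some weights `0 ≤ ρ_k ≤ 2^-(k+2)` every
`O`-row `O(2^k, A, ρ_k)` (`A < 2^k`, `k + 2 ≤ q`) holds for every tree, then `TTlow q`. -/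
theorem TTlow_of_oRows_level (rho : ℕ → ℚ) (h0 : ∀ k, k + 2 ≤ q → 0 ≤ rho k)
    (hle : ∀ k, k + 2 ≤ q → rho k ≤ (2 : ℚ) ^ (-((k : ℤ) + 2)))
    (hO : ∀ (k : ℕ) (t : SumTree) (A : ℕ), k + 2 ≤ q → A < 2 ^ k → ORow q t (rho k) k A) :
    TTlow q := by
  refine TTlow_of_rows rho h0 (fun k hk => (hle k hk).trans ?_) hO (eSide_level rho h0 hle)
  have : (2 : ℚ) ^ (-((k : ℤ) + 2)) ≤ (2 : ℚ) ^ (0 : ℤ) := zpow_le_zpow_right₀ (by norm_num) (by omega)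
  exact this.trans (by norm_num)

/-- **CONJECTURE D FOR EVERY TREE FROM THE O-ROWS AT PER-LEVEL WEIGHTS** (`q ≥ 2`): `O`-rows for every
tree at some weights `0 ≤ ρ_k ≤ 2^-(k+2)` ⟹ for every `p ≥ 1`, any nearest roundings into
`F(q, emin)` / `F(p, emin)` and every summation tree of nonnegative `F(q, emin)` data,
`s ≤ Q_t · fl_p(ŝ)`. -/
theorem conjectureD_of_oRows_level (hq : 2 ≤ q) (rho : ℕ → ℚ) (h0 : ∀ k, k + 2 ≤ q → 0 ≤ rho k)
    (hle : ∀ k, k + 2 ≤ q → rho k ≤ (2 : ℚ) ^ (-((k : ℤ) + 2)))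
    (hO : ∀ (k : ℕ) (t : SumTree) (A : ℕ), k + 2 ≤ q → A < 2 ^ k → ORow q t (rho k) k A)
    {p : ℕ} (hp : 1 ≤ p) {emin : ℤ} {fl flp : ℚ → ℚ} (hfl : IsRoundNearest q emin fl)
    (hflp : IsRoundNearest p emin flp) (t : SumTree) (ht : ∀ x ∈ leaves t, IsFloat q emin x ∧ 0 ≤ x) :
    exact t ≤ treeQf (unitRoundoff q) t (unitRoundoff p) * flp (eval fl t) :=
  conjectureD_of_TTlow hp hq (TTlow_of_oRows_level rho h0 hle hO) hfl hflp t ht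

/-- The routing conjecture (W = BR) for every shape from the `O`-rows at per-level weights (`q ≥ 2`). -/
theorem routingBound_of_oRows_level (hq : 2 ≤ q) (rho : ℕ → ℚ) (h0 : ∀ k, k + 2 ≤ q → 0 ≤ rho k)
    (hle : ∀ k, k + 2 ≤ q → rho k ≤ (2 : ℚ) ^ (-((k : ℤ) + 2)))
    (hO : ∀ (k : ℕ) (t : SumTree) (A : ℕ), k + 2 ≤ q → A < 2 ^ k → ORow q t (rho k) k A)
    (s : Shape) : RoutingBound q s :=
  routingBound_of_TTlow hq (TTlow_of_oRows_level rho h0 hle hO) s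

/-! ## The weight `u` at every level (Part 11's statements as corollaries) -/

/-- **EVERY `E`-ROW AT `ρ = u`** (`u = 2^-q ≤ 2^-(k+2)` at every level `k + 2 ≤ q`): for any offset
`B < 2^k` and every tree, `E(2^k, B, u)` — the hypothesis `hE` of part 10e `TTlow_of_rows` at the
uniform weight `u`. -/
theorem eRow_all (t : SumTree) {k B : ℕ} (hk : k + 2 ≤ q) (hB : B < 2 ^ k) :
    ERow q t (unitRoundoff q) k B :=
  eRow_level t hk hB (unitRoundoff_nonneg q)
    (by rw [unitRoundoff_eq_zpow]; exact zpow_le_zpow_right₀ (by norm_num) (by omega))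

/-- The whole e-side of the row system at the uniform weight `u`. -/
theorem eSide_all : ∀ (k : ℕ) (t : SumTree) (B : ℕ), k + 2 ≤ q → B < 2 ^ k → ERow q t (unitRoundoff q) k B :=
  fun _ t _ hk hB => eRow_all t hk hB

/-- R29 from the `O`-rows alone at weights `≤ u` (the special case `ρ_k ≤ u` of `TTlow_of_oRows_level`;
by opt's R22 satisfiable at every level only for small `q` — use the per-level version). -/
theorem TTlow_of_oRows (rho : ℕ → ℚ) (h0 : ∀ k, k + 2 ≤ q → 0 ≤ rho k)
    (hu : ∀ k, k + 2 ≤ q → rho k ≤ unitRoundoff q)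
    (hO : ∀ (k : ℕ) (t : SumTree) (A : ℕ), k + 2 ≤ q → A < 2 ^ k → ORow q t (rho k) k A) :
    TTlow q :=
  TTlow_of_oRows_level rho h0 (fun k hk => (hu k hk).trans
    (by rw [unitRoundoff_eq_zpow]; exact zpow_le_zpow_right₀ (by norm_num) (by omega))) hO

/-- Conjecture D for every tree from the `O`-rows alone at weights `≤ u` (`q ≥ 2`). -/
theorem conjectureD_of_oRows (hq : 2 ≤ q) (rho : ℕ → ℚ) (h0 : ∀ k, k + 2 ≤ q → 0 ≤ rho k)
    (hu : ∀ k, k + 2 ≤ q → rho k ≤ unitRoundoff q)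
    (hO : ∀ (k : ℕ) (t : SumTree) (A : ℕ), k + 2 ≤ q → A < 2 ^ k → ORow q t (rho k) k A)
    {p : ℕ} (hp : 1 ≤ p) {emin : ℤ} {fl flp : ℚ → ℚ} (hfl : IsRoundNearest q emin fl)
    (hflp : IsRoundNearest p emin flp) (t : SumTree) (ht : ∀ x ∈ leaves t, IsFloat q emin x ∧ 0 ≤ x) :
    exact t ≤ treeQf (unitRoundoff q) t (unitRoundoff p) * flp (eval fl t) :=
  conjectureD_of_TTlow hp hq (TTlow_of_oRows rho h0 hu hO) hfl hflp t ht

end ERowsLevel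

end Summit.Ventures.CertifiedArithmetic.LowPrec.Opt
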